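import Literature.NumberTheory.LFunctions.HardyZRiemannSiegelEvaluationExplicit
import Literature.NumberTheory.LFunctions.RiemannHypothesisUpToRSCertificate
import HarnessLib

/-!
# The Turing-method run checker fed by the Riemann–Siegel evaluator WITHOUT a named fact

Topic `Literature/NumberTheory/LFunctions` (with `Analysis/ValidatedNumerics`). The run checker of
`RiemannHypothesisUpToRSCertificate.lean` (`Literature.NumberTheory.LFunctions.RSCert.checkChunk`,
`checkStart`; soundness `altRun_of_checkChunk`, `sgnZ_of_checkStart`) certifies alternating signs of
Hardy's `Z` along dyadic sample runs, the Riemann–Siegel signs being conditional on Gabcke's remainder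
bound `Gabcke.satz322b_R0` (a named fact). This file is the same checker on top of the evaluator
`Literature.NumberTheory.LFunctions.RSEval.hardyZBoxX` (`HardyZRiemannSiegelEvaluationExplicit.lean`),
whose remainder term is the tree's PROVED bound `Gabcke.abs_R0_le_explicit_of_ge`
(`RiemannSiegelRemainderK0.lean`); every soundness theorem here is therefore free of named-fact
hypotheses:

* `signRSX`, `signAtX`, `checkGapsX`, `checkBlocksX`, `checkChunkX`, `checkStartX` — the executable
  checks (same certificate format: blocks `(N, gaps)`, method code `N ≥ 1` = Riemann–Siegel with
  main-sum length `N`, `N = 0` = Euler–Maclaurin `zetaBoxK`), and their soundness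
  `sgnZ_of_signRSX`, `altRun_of_checkChunkX`, `sgnZ_of_checkStartX`;
* `altRun_of_checkChunk_em`, `sgnZ_of_checkStart_zero` — the ORIGINAL checks are already
  unconditional when every block uses the Euler–Maclaurin method (code `0`), so landed
  Euler–Maclaurin chunk theorems (e.g. `RiemannHypothesisUpTo1000K01/K02.lean`, `t < 200`) are
  re-used verbatim.

The run algebra (`AltRun`, `altRun_append`, `exists_fin_of_altRun`), the Turing inequality check
`checkHnum` and the assembly `zetaZerosSimpleOnLineUpTo_of_runs` of the original file involve no
named fact and are used as they are. Consumers: the unconditional heights `RiemannHypothesisUpTo 10⁵`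
(compiled) and `10³` (kernel).

## References

* W. Gabcke, Dissertation Göttingen 1979, Satz 3.2.2. [Gabcke1979]
* R. P. Brent, Math. Comp. 33 (1979), §3–§4 (sign changes; Theorems 3.1–3.2). [Brent1979]
* H. M. Edwards, *Riemann's Zeta Function* (1974), §6.5, §8.2 (Turing's method). [EdwardsZeta1974]
-/

open Finset Complex
open Literature.Analysis.ValidatedNumerics Literature.Analysis.ValidatedNumerics.NumericsMP
open Literature.NumberTheory.LFunctions Literature.NumberTheory.LFunctions.ZetaNumerics
open Literature.NumberTheory.LFunctions.RSEval
open scoped Real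

namespace Literature.NumberTheory.LFunctions.RSCert

/-! ## 1. Euler–Maclaurin-only runs of the original checker are unconditional -/

/-- Soundness of `signAt` with method code `0` (Euler–Maclaurin): no named fact. [cite: EdwardsZeta1974, §6.5] -/
theorem sgnZ_of_signAt_zero {R : RSTables} (hR : R.Valid) {T : Tables} (hT : T.Valid) {e p : ℕ}
    {s : Bool} (h : signAt R T e 0 p = some s) : sgnZ e p s := by
  unfold signAt at h
  simp only [↓reduceIte] at h
  exact sgnZ_of_signEM hR hT h

/-- Soundness of `checkGaps` with method code `0`: no named fact. [cite: Brent1979, §3] -/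
theorem altRun_of_checkGaps_zero {R : RSTables} (hR : R.Valid) {T : Tables} (hT : T.Valid) {e : ℕ} :
    ∀ (gs : List ℕ) (p : ℕ) (s : Bool) {p' : ℕ} {s' : Bool},
    sgnZ e p s → checkGaps R T e 0 p s gs = some (p', s') →
      AltRun e p s gs ∧ p + gs.sum = p' ∧ sgnZ e p' s'
  | [], p, s, p', s', hp, h => by
    simp only [checkGaps, Option.some.injEq, Prod.mk.injEq] at h
    obtain ⟨rfl, rfl⟩ := h
    exact ⟨hp, by simp, hp⟩
  | g :: gs, p, s, p', s', hp, h => by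
    simp only [checkGaps] at h
    split_ifs at h with hc
    obtain ⟨hg, hsg⟩ := hc
    have hnext := sgnZ_of_signAt_zero hR hT hsg
    obtain ⟨hrun, hsum, hlast⟩ := altRun_of_checkGaps_zero hR hT gs (p + g) (!s) hnext h
    exact ⟨⟨hp, hg, hrun⟩, by simp [List.sum_cons, ← hsum, add_assoc], hlast⟩

/-- Soundness of `checkBlocks` when every block has method code `0`: no named fact. [cite: Brent1979, §3] -/
theorem altRun_of_checkBlocks_em {R : RSTables} (hR : R.Valid) {T : Tables} (hT : T.Valid) {e : ℕ} :
    ∀ (bs : List (ℕ × List ℕ)) (p : ℕ) (s : Bool) {p' : ℕ} {s' : Bool}, (∀ b ∈ bs, b.1 = 0) →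
    sgnZ e p s → checkBlocks R T e p s bs = some (p', s') →
      AltRun e p s (flatten bs) ∧ p + (flatten bs).sum = p' ∧ sgnZ e p' s'
  | [], p, s, p', s', _, hp, h => by
    simp only [checkBlocks, Option.some.injEq, Prod.mk.injEq] at h
    obtain ⟨rfl, rfl⟩ := h
    exact ⟨by simpa [flatten, AltRun] using hp, by simp [flatten], hp⟩
  | (N, gs) :: bs, p, s, p', s', hbs, hp, h => by
    have hN : N = 0 := hbs (N, gs) (by simp)
    subst hN
    simp only [checkBlocks] at h
    split at h
    · rename_i p₁ s₁ h₁
      obtain ⟨hrun₁, hsum₁, hlast₁⟩ := altRun_of_checkGaps_zero hR hT gs p s hp h₁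
      obtain ⟨hrun₂, hsum₂, hlast₂⟩ := altRun_of_checkBlocks_em hR hT bs p₁ s₁
        (fun b hb ↦ hbs b (by simp [hb])) hlast₁ h
      refine ⟨?_, ?_, hlast₂⟩
      · simp only [flatten]
        exact altRun_append hrun₁ (hsum₁ ▸ hrun₂)
      · simp [flatten, List.sum_append, ← hsum₂, ← hsum₁, add_assoc]
    · simp at h

/-- **Soundness of the ORIGINAL chunk check for Euler–Maclaurin-only chunks, unconditionally**: if
every block of `bs` has method code `0`, the sign `s` at `p` is certified and
`checkChunk … p s bs = some (p', s')`, then the gaps form a run from `p` ending at `p'` with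
certified sign `s'` — with no named-fact hypothesis. [cite: Brent1979, §3] -/
theorem altRun_of_checkChunk_em {Nrs Nem nu e p : ℕ} {s : Bool} {bs : List (ℕ × List ℕ)}
    {p' : ℕ} {s' : Bool} (hbs : ∀ b ∈ bs, b.1 = 0) (hp : sgnZ e p s)
    (h : checkChunk Nrs Nem nu e p s bs = some (p', s')) :
    AltRun e p s (flatten bs) ∧ p + (flatten bs).sum = p' ∧ sgnZ e p' s' := by
  unfold checkChunk at h
  split at h
  · rename_i R T hR hT
    exact altRun_of_checkBlocks_em (rsTablesWith_valid hR) (RHUpToCert.tablesWith_valid hT) bs p s hbs hp h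
  · simp at h

/-- Soundness of the ORIGINAL start check with method code `0` (Euler–Maclaurin), unconditionally.
[cite: Brent1979, §3] -/
theorem sgnZ_of_checkStart_zero {Nrs Nem nu e p : ℕ} {s : Bool}
    (h : checkStart Nrs Nem nu e 0 p s = true) : sgnZ e p s := by
  unfold checkStart at h
  split at h
  · rename_i R T hR hT
    exact sgnZ_of_signAt_zero (rsTablesWith_valid hR) (RHUpToCert.tablesWith_valid hT)
      (of_decide_eq_true h)
  · simp at h

/-! ## 2. Certified signs with the proved remainder -/

/-- The sign of `Z(p/2^e)` from the Riemann–Siegel enclosure `hardyZBoxX X p e N` (proved remainder;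
`some true`: positive, `some false`: negative, `none`: undecided). [cite: Gabcke1979, Satz 3.2.2 p. 55] -/
def signRSX (X : RSTablesX) (e p N : ℕ) : Option Bool :=
  match hardyZBoxX X p e N with
  | some B => if 0 < B.lo then some true else if B.hi < 0 then some false else none
  | none => none

/-- Soundness of `signRSX` — no named fact. [cite: Gabcke1979, Satz 3.2.2 p. 55] -/
theorem sgnZ_of_signRSX {X : RSTablesX} (hX : X.Valid) {e p N : ℕ} {s : Bool}
    (h : signRSX X e p N = some s) : sgnZ e p s := by
  unfold signRSX at h
  split at h
  · rename_i B hB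
    have hm := mem_hardyZBoxX hX hB
    split_ifs at h with h1 h2
    · simp only [Option.some.injEq] at h
      subst h
      simpa [sgnZ] using MI.pos_of_lo_pos hm h1
    · simp only [Option.some.injEq] at h
      subst h
      simpa [sgnZ] using MI.neg_of_hi_neg hm h2
  · simp at h

/-- The sign of `Z(p/2^e)` by the method with code `N`: `N = 0` Euler–Maclaurin (`signEM`), `N ≥ 1`
Riemann–Siegel with main-sum length `N` and the proved remainder (`signRSX`).
[cite: Gabcke1979, Satz 3.2.2 p. 55] -/
def signAtX (X : RSTablesX) (T : Tables) (e N p : ℕ) : Option Bool :=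
  if N = 0 then signEM X.R T e p else signRSX X e p N

/-- Soundness of `signAtX` — no named fact. [cite: Gabcke1979, Satz 3.2.2 p. 55] -/
theorem sgnZ_of_signAtX {X : RSTablesX} (hX : X.Valid) {T : Tables} (hT : T.Valid) {e N p : ℕ}
    {s : Bool} (h : signAtX X T e N p = some s) : sgnZ e p s := by
  unfold signAtX at h
  split_ifs at h
  · exact sgnZ_of_signEM hX.R_valid hT h
  · exact sgnZ_of_signRSX hX h

/-! ## 3. The executable run checks -/

/-- Check one block of gaps with method code `N` from the point `p` with certified sign `s` (as
`checkGaps`, signs by `signAtX`). [cite: Brent1979, §3] -/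
def checkGapsX (X : RSTablesX) (T : Tables) (e N : ℕ) : ℕ → Bool → List ℕ → Option (ℕ × Bool)
  | p, s, [] => some (p, s)
  | p, s, g :: gs =>
    if 0 < g ∧ signAtX X T e N (p + g) = some (!s) then checkGapsX X T e N (p + g) (!s) gs else none

/-- Check a list of blocks `(N, gaps)` (as `checkBlocks`, signs by `signAtX`). [cite: Brent1979, §3] -/
def checkBlocksX (X : RSTablesX) (T : Tables) (e : ℕ) : ℕ → Bool → List (ℕ × List ℕ) → Option (ℕ × Bool)
  | p, s, [] => some (p, s)
  | p, s, (N, gs) :: bs =>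
    match checkGapsX X T e N p s gs with
    | some (p', s') => checkBlocksX X T e p' s' bs
    | none => none

/-- Soundness of `checkGapsX` — no named fact. [cite: Brent1979, §3] -/
theorem altRun_of_checkGapsX {X : RSTablesX} (hX : X.Valid) {T : Tables} (hT : T.Valid) {e N : ℕ} :
    ∀ (gs : List ℕ) (p : ℕ) (s : Bool) {p' : ℕ} {s' : Bool},
    sgnZ e p s → checkGapsX X T e N p s gs = some (p', s') →
      AltRun e p s gs ∧ p + gs.sum = p' ∧ sgnZ e p' s'
  | [], p, s, p', s', hp, h => by
    simp only [checkGapsX, Option.some.injEq, Prod.mk.injEq] at h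
    obtain ⟨rfl, rfl⟩ := h
    exact ⟨hp, by simp, hp⟩
  | g :: gs, p, s, p', s', hp, h => by
    simp only [checkGapsX] at h
    split_ifs at h with hc
    obtain ⟨hg, hsg⟩ := hc
    have hnext := sgnZ_of_signAtX hX hT hsg
    obtain ⟨hrun, hsum, hlast⟩ := altRun_of_checkGapsX hX hT gs (p + g) (!s) hnext h
    exact ⟨⟨hp, hg, hrun⟩, by simp [List.sum_cons, ← hsum, add_assoc], hlast⟩

/-- Soundness of `checkBlocksX` — no named fact. [cite: Brent1979, §3] -/
theorem altRun_of_checkBlocksX {X : RSTablesX} (hX : X.Valid) {T : Tables} (hT : T.Valid) {e : ℕ} :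
    ∀ (bs : List (ℕ × List ℕ)) (p : ℕ) (s : Bool) {p' : ℕ} {s' : Bool},
    sgnZ e p s → checkBlocksX X T e p s bs = some (p', s') →
      AltRun e p s (flatten bs) ∧ p + (flatten bs).sum = p' ∧ sgnZ e p' s'
  | [], p, s, p', s', hp, h => by
    simp only [checkBlocksX, Option.some.injEq, Prod.mk.injEq] at h
    obtain ⟨rfl, rfl⟩ := h
    exact ⟨by simpa [flatten, AltRun] using hp, by simp [flatten], hp⟩
  | (N, gs) :: bs, p, s, p', s', hp, h => by
    simp only [checkBlocksX] at h
    split at h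
    · rename_i p₁ s₁ h₁
      obtain ⟨hrun₁, hsum₁, hlast₁⟩ := altRun_of_checkGapsX hX hT gs p s hp h₁
      obtain ⟨hrun₂, hsum₂, hlast₂⟩ := altRun_of_checkBlocksX hX hT bs p₁ s₁ hlast₁ h
      refine ⟨?_, ?_, hlast₂⟩
      · simp only [flatten]
        exact altRun_append hrun₁ (hsum₁ ▸ hrun₂)
      · simp [flatten, List.sum_append, ← hsum₂, ← hsum₁, add_assoc]
    · simp at h

/-- **The chunk check with the proved remainder**, tables built inside (`rsTablesXWith Nrs` for
Riemann–Siegel main sums of length `≤ Nrs` plus the six remainder constants; Euler–Maclaurin tables of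
cut-off `Nem` and order `ν`; scale `2^60`): from the point `p` with known sign `s`, check the blocks
`bs`. Same certificate format as `checkChunk`. [cite: Brent1979, §3] -/
def checkChunkX (Nrs Nem nu e p : ℕ) (s : Bool) (bs : List (ℕ × List ℕ)) : Option (ℕ × Bool) :=
  match rsTablesXWith Nrs, RHUpToCert.tablesWith Nem nu with
  | some X, some T => checkBlocksX X T e p s bs
  | _, _ => none

/-- **The start check with the proved remainder**: the sign `s` at the point `p`, certified directly by
the method with code `N`. [cite: Brent1979, §3] -/
def checkStartX (Nrs Nem nu e N p : ℕ) (s : Bool) : Bool :=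
  match rsTablesXWith Nrs, RHUpToCert.tablesWith Nem nu with
  | some X, some T => decide (signAtX X T e N p = some s)
  | _, _ => false

/-- Soundness of `checkStartX` — no named fact. [cite: Brent1979, §3] -/
theorem sgnZ_of_checkStartX {Nrs Nem nu e N p : ℕ} {s : Bool}
    (h : checkStartX Nrs Nem nu e N p s = true) : sgnZ e p s := by
  unfold checkStartX at h
  split at h
  · rename_i X T hX hT
    exact sgnZ_of_signAtX (rsTablesXWith_valid hX) (RHUpToCert.tablesWith_valid hT)
      (of_decide_eq_true h)
  · simp at h

/-- **Soundness of the chunk check with the proved remainder — no named fact**: if the sign `s` at `p`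
is certified and `checkChunkX … p s bs = some (p', s')`, then the gaps `flatten bs` form a run from
`p` with initial sign `s`, ending at `p' = p + Σ` with certified sign `s'`. Feed the runs to
`zetaZerosSimpleOnLineUpTo_of_runs`. [cite: Brent1979, §3 Theorems 3.1–3.2] -/
theorem altRun_of_checkChunkX {Nrs Nem nu e p : ℕ} {s : Bool}
    {bs : List (ℕ × List ℕ)} {p' : ℕ} {s' : Bool} (hp : sgnZ e p s)
    (h : checkChunkX Nrs Nem nu e p s bs = some (p', s')) :
    AltRun e p s (flatten bs) ∧ p + (flatten bs).sum = p' ∧ sgnZ e p' s' := by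
  unfold checkChunkX at h
  split at h
  · rename_i X T hX hT
    exact altRun_of_checkBlocksX (rsTablesXWith_valid hX) (RHUpToCert.tablesWith_valid hT) bs p s hp h
  · simp at h

end Literature.NumberTheory.LFunctions.RSCert
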